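import Mathlib.Data.ZMod.Basic
import Mathlib.Data.Nat.GCD.BigOperators
import Mathlib.Data.Fintype.Card
import Mathlib.Data.Fintype.Prod
import Mathlib.Tactic.NormNum
import HarnessLib

/-!
# Venture HSemireg — the CRT multiplicativity behind «the residues `A mod d` with `A² ≡ −2` number `2^{ω(d′)}`» (THEOREM 35-B, ENGINE-W
# PROBE5 §35 (3)): `#{x ∈ ℤ∕mn : x² = a} = #{x ∈ ℤ∕m : x² = a} · #{x ∈ ℤ∕n : x² = a}` for coprime `m, n` — kernel algebra

HONEST FRAMING. Lean index of the computation cell `pub-hsemireg`, widening group ENGINE-W (code A, seat `engine-w-1`, gen 17).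
ELEMENTARY MODULAR ARITHMETIC (Chinese remainder theorem, Mathlib's `ZMod.chineseRemainder`); no abelian variety, sheaf, `Ext` group,
secant structure or semiregularity map is constructed; nothing here says that HC, HC_CM or HC_AV holds. Theorems only (0 `def`, 0 named
fact, 0 `sorry`). New namespace `RootCountCRT`; companions `TargetResidueCounts.lean` (the counts at the determinants of record by `decide`)
and `NoProductOfLocalSigns.lean` (`d = 561`).

SOURCE (the cell's own result): `widen/ENGINE-W/out/probe5/PROBE5-STIZ-A.md` §35 (3) THEOREM 35-B: «The residues `A mod d` with `A² ≡ −2`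
number `2^{ω(d′)}` (`d′` = odd part of `d` …)» — the multiplicative structure is the Chinese remainder theorem; the local counts (`2` per odd
prime power `ℓ^e ∥ d` with `(−2∕ℓ) = 1`, `1` for the factor `2`) are in `TargetResidueCounts.lean` for the primes of record. What the kernel
holds:

* §1 **`card_sq_eq_mul`** — for coprime `m, n` and any integer `a`: `|{x : ℤ∕(mn) // x² = a}| = |{x : ℤ∕m // x² = a}| · |{x : ℤ∕n // x² = a}|`
  (transport along `ZMod.chineseRemainder`, then `Equiv.subtypeProdEquivProd`).
* §2 instances for `a = −2`: `33 = 3·11` (`2·2 = 4`), `187 = 11·17`, `561 = 33·17` (`4·2 = 8`), `1122 = 2·561` (`1·8 = 8`) — the printed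
  `2^{ω(d′)}` at the three-prime determinants, now as CRT products of the local counts rather than one big enumeration.
* §3 **`natCard_sq_list_prod`** — the same for any LIST of pairwise coprime nonzero moduli (`#{ℤ∕∏l} = ∏ #{ℤ∕n}`, `Nat.card` form, by
  induction), `natCard_sq_one`, and `natCard_561_list` (`[3, 11, 17] ↦ 2·2·2`): the `2^{ω(d′)}` shape for squarefree `d′`.
WHAT IS NOT HERE: Hensel lifting for `ℓ^e` (the prime-power counts are enumerated, not derived), THEOREM 35-B's isometries.
-/

namespace Summit.Ventures.HSemireg.RootCountCRT

/-! ## §1 Multiplicativity of the square-root count -/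

/-- **CRT multiplicativity**: for coprime `m, n` and an integer `a`, the solutions of `x² = a` in `ℤ∕(mn)` correspond to pairs of
solutions in `ℤ∕m` and `ℤ∕n`; hence the counts multiply. [kernel] -/
theorem card_sq_eq_mul (m n : ℕ) [NeZero m] [NeZero n] (h : m.Coprime n) (a : ℤ) :
    Fintype.card {x : ZMod (m * n) // x ^ 2 = a}
      = Fintype.card {x : ZMod m // x ^ 2 = a} * Fintype.card {x : ZMod n // x ^ 2 = a} := by
  let e := ZMod.chineseRemainder h
  have key : ∀ x : ZMod (m * n), x ^ 2 = (a : ZMod (m * n)) ↔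
      ((e x).1 ^ 2 = (a : ZMod m) ∧ (e x).2 ^ 2 = (a : ZMod n)) := by
    intro x
    constructor
    · intro hx
      have h1 := congrArg (fun z => (e z).1) hx
      have h2 := congrArg (fun z => (e z).2) hx
      simp only [map_pow, map_intCast, Prod.pow_fst, Prod.pow_snd, Prod.fst_intCast, Prod.snd_intCast] at h1 h2
      exact ⟨h1, h2⟩
    · rintro ⟨h1, h2⟩
      apply e.injective
      rw [map_pow, map_intCast]
      exact Prod.ext (by simpa using h1) (by simpa using h2)
  rw [← Fintype.card_prod]
  refine Fintype.card_congr ((Equiv.subtypeEquiv e.toEquiv (p := fun x : ZMod (m * n) => x ^ 2 = (a : ZMod (m * n)))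
    (q := fun y : ZMod m × ZMod n => y.1 ^ 2 = (a : ZMod m) ∧ y.2 ^ 2 = (a : ZMod n)) key).trans ?_)
  exact Equiv.subtypeProdEquivProd (p := fun x : ZMod m => x ^ 2 = (a : ZMod m)) (q := fun y : ZMod n => y ^ 2 = (a : ZMod n))

/-! ## §2 The local counts and the three-prime determinants as CRT products -/

/-- Local counts for `a = −2` (the primes of record and the factor `2`): `|{x² = −2}| = 1, 2, 2, 2, 2` in `ℤ∕2, ℤ∕3, ℤ∕11, ℤ∕17, ℤ∕19`.
[kernel, `decide`] -/
theorem local_counts :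
    Fintype.card {x : ZMod 2 // x ^ 2 = ((-2 : ℤ) : ZMod 2)} = 1 ∧
    Fintype.card {x : ZMod 3 // x ^ 2 = ((-2 : ℤ) : ZMod 3)} = 2 ∧
    Fintype.card {x : ZMod 11 // x ^ 2 = ((-2 : ℤ) : ZMod 11)} = 2 ∧
    Fintype.card {x : ZMod 17 // x ^ 2 = ((-2 : ℤ) : ZMod 17)} = 2 ∧
    Fintype.card {x : ZMod 19 // x ^ 2 = ((-2 : ℤ) : ZMod 19)} = 2 := by
  refine ⟨?_, ?_, ?_, ?_, ?_⟩ <;> decide +kernel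

/-- **`d = 33 = 3·11`: `2·2 = 4` roots** of `x² = −2`, by CRT. [kernel] -/
theorem count_33 : Fintype.card {x : ZMod (3 * 11) // x ^ 2 = ((-2 : ℤ) : ZMod (3 * 11))} = 4 := by
  rw [card_sq_eq_mul 3 11 (by decide) (-2)]
  decide +kernel

/-- **`d = 187 = 11·17`: `4` roots**, by CRT. [kernel] -/
theorem count_187 : Fintype.card {x : ZMod (11 * 17) // x ^ 2 = ((-2 : ℤ) : ZMod (11 * 17))} = 4 := by
  rw [card_sq_eq_mul 11 17 (by decide) (-2)]
  decide +kernel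

/-- **`d = 561 = (3·11)·17`: `4·2 = 8 = 2³` roots** («`2^{ω(d′)}`, `ω = 3`), by CRT twice. [kernel] -/
theorem count_561 : Fintype.card {x : ZMod (3 * 11 * 17) // x ^ 2 = ((-2 : ℤ) : ZMod (3 * 11 * 17))} = 8 := by
  rw [card_sq_eq_mul (3 * 11) 17 (by decide) (-2), card_sq_eq_mul 3 11 (by decide) (-2)]
  decide +kernel

/-- **`d = 1122 = 2·561`: `1·8 = 8` roots** (the factor `2` contributes one root: `d′ = 561`), by CRT. [kernel] -/
theorem count_1122 : Fintype.card {x : ZMod (2 * (3 * 11 * 17)) // x ^ 2 = ((-2 : ℤ) : ZMod (2 * (3 * 11 * 17)))} = 8 := by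
  rw [card_sq_eq_mul 2 (3 * 11 * 17) (by decide) (-2), count_561]
  decide +kernel

/-! ## §3 Pairwise-coprime products: the `2^{ω}` structure -/

/-- `ℤ∕1`: every element is a root, and there is exactly one element. [kernel] -/
theorem natCard_sq_one (a : ℤ) : Nat.card {x : ZMod 1 // x ^ 2 = (a : ZMod 1)} = 1 := by
  have h : ∀ x : ZMod 1, x ^ 2 = (a : ZMod 1) := fun x => Subsingleton.elim _ _
  rw [Nat.card_congr (Equiv.subtypeUnivEquiv h), Nat.card_eq_fintype_card, ZMod.card]

/-- **Pairwise-coprime products**: for a list of pairwise coprime, nonzero moduli `l` and `N = ∏ l`,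
`#{x ∈ ℤ∕N : x² = a} = ∏_{n ∈ l} #{x ∈ ℤ∕n : x² = a}` — so for squarefree odd `d′ = ℓ₁⋯ℓ_ω` with two roots modulo each `ℓ_i` the count
is `2^{ω(d′)}`, and a factor `2` (one root) does not change it («`2^{ω(d′)}`, `d′` = odd part of `d`»). [kernel] -/
theorem natCard_sq_list_prod (a : ℤ) :
    ∀ (l : List ℕ), l.Pairwise Nat.Coprime → (0 : ℕ) ∉ l → ∀ (N : ℕ) [NeZero N], N = l.prod →
      Nat.card {x : ZMod N // x ^ 2 = (a : ZMod N)} = (l.map fun n => Nat.card {x : ZMod n // x ^ 2 = (a : ZMod n)}).prod := by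
  intro l
  induction l with
  | nil =>
    intro _ _ N _ hN
    simp only [List.prod_nil] at hN
    subst hN
    simpa using natCard_sq_one a
  | cons n l ih =>
    intro hl h0 N _ hN
    rw [List.pairwise_cons] at hl
    rw [List.mem_cons, not_or] at h0
    have hn0 : n ≠ 0 := fun h => h0.1 h.symm
    have hl0 : (0 : ℕ) ∉ l := h0.2
    haveI : NeZero n := ⟨hn0⟩
    have hprod0 : l.prod ≠ 0 := List.prod_ne_zero hl0
    haveI : NeZero l.prod := ⟨hprod0⟩
    have hcop : n.Coprime l.prod := Nat.coprime_list_prod_right_iff.2 hl.1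
    rw [List.prod_cons] at hN
    subst hN
    rw [List.map_cons, List.prod_cons, ← ih hl.2 hl0 l.prod rfl, Nat.card_eq_fintype_card, Nat.card_eq_fintype_card,
      Nat.card_eq_fintype_card]
    exact card_sq_eq_mul n l.prod hcop a

/-- **`561 = 3·11·17` once more, as a pairwise-coprime product**: `2·2·2 = 8`. [kernel] -/
theorem natCard_561_list : Nat.card {x : ZMod 561 // x ^ 2 = ((-2 : ℤ) : ZMod 561)} = 8 := by
  rw [natCard_sq_list_prod (-2) [3, 11, 17] (by decide) (by decide) 561 (by norm_num)]
  simp only [List.map_cons, List.map_nil, List.prod_cons, List.prod_nil, Nat.card_eq_fintype_card]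
  decide +kernel

end Summit.Ventures.HSemireg.RootCountCRT
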